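import Literature.Probability.Entropy.FiniteShannon
import HarnessLib

/-!
# Decoupling two weakly dependent random variables through entropy (Tao 2016, Lemmas 3.3–3.5)

Topic `Literature/Probability/Entropy`.  Everything in this file is PROVED; it is stated in the
vocabulary of `Literature.Probability.Entropy.FiniteShannon` (`Literature.FiniteShannon`).

This is the probabilistic heart of §3 of T. Tao, *The logarithmically averaged Chowla and Elliott
conjectures for two-point correlations* (Forum Math. Pi 4 (2016) e8), isolated as one abstract
statement.  There, once the entropy decrement argument has produced a scale with small mutual
information `𝐈(X_H : Y_H)`, the paper argues (§3, from the paragraph on good values after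
Lemma 3.2 to the decoupled expectation bound preceding Lemma 3.6):

* *good values* (Markov): since `𝐈(X : Y) = ∑_x ℙ(X = x)(𝐇(Y) - 𝐇(Y | X = x))` with summands
  `≥ -o(1)` (because `𝐇(Y) ≥ log N - o(1)` and `𝐇(Y | X = x) ≤ log N`), most `x` have a small
  entropy drop `𝐇(Y) - 𝐇(Y | X = x)`;
* **Lemma 3.3** (weak uniform distribution): for such `x`, `Y` conditioned on `X = x` gives
  small mass to any set `E_x` of size `≤ e^{-θ} N`;
* **Lemma 3.5** supplies, for each `x`, such a small exceptional set `E_x` outside of which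
  `F(x, y)` is within `λ` of its `y`-average (Hoeffding);
* Fubini then gives `F(X, Y) = (average over y) + O(λ)` outside an event of probability `o(1)`,
  hence in expectation, as `F` is bounded (the two displays after the proof of Lemma 3.5).

`wsum_div_mass_le_of_mutualInfo_le` proves the resulting inequality for an arbitrary finite
weighted set `(s, w)`, random variables `X, Y` (`Y` valued in a finite set `T`, `#T = N`), and a
"deviation" `d(x, y) ≤ D` (in the paper `d(x,y) = |F(x,y) - P_H⁻¹ ∑_{y'} F(x,y')|`, `D = O(H/log H)`):
if `𝐇(Y) ≥ log N - η`, `𝐈(X : Y) ≤ κ`, and for every value `x` the set `{y ∈ T : d(x,y) ≥ λ}`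
has at most `e^{-θ} N` elements, then for every `τ > 0`

  `𝔼 d(X, Y) ≤ λ + D · ((log 2 + η + τ)/θ + (κ + η)/τ)`.

## References
* T. Tao, Forum Math. Pi 4 (2016), e8; arXiv:1509.05422, §3: the paragraph on good values after
  Lemma 3.2, Lemma 3.3 and its proof, Lemma 3.5, and the two displays following its proof.

## Design choices
* Expectations are written `(∑_{i ∈ s} w i · f i) / mass s w`; no new definition.
* The deviation `d` is real-valued and the concentration input is a hypothesis, so that the file
  does not depend on the Hoeffding files; the constants are explicit and `τ` is free.
-/

open Finset Real

namespace Literature.Probability.Entropy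

namespace FiniteShannon

variable {ι α β : Type*} [DecidableEq α] [DecidableEq β] {s : Finset ι} {w : ι → ℝ}

/-- The mass of a sub-event of a fibre is the conditional probability times the fibre mass
(also when the fibre is null). [folklore] -/
theorem mass_filter_eq_prob_mul_mass (hw : ∀ i ∈ s, 0 ≤ w i) (P : ι → Prop) [DecidablePred P] :
    mass (s.filter fun i => decide (P i) = true) w =
      prob s w (fun i => decide (P i)) true * mass s w := by
  rw [prob_def]
  rcases (mass_nonneg hw).eq_or_lt with h0 | hpos
  · rw [← h0, mul_zero]
    refine le_antisymm ?_ (mass_nonneg fun i hi => hw i (mem_of_mem_filter i hi))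
    calc mass (s.filter fun i => decide (P i) = true) w ≤ mass s w := mass_filter_le _ hw
      _ = 0 := h0.symm
  · rw [div_mul_cancel₀ _ hpos.ne']

/-- **Entropy decoupling** (Tao 2016, §3: Markov for good values + Lemma 3.3 + Lemma 3.5 +
Fubini, abstract form).  On a finite weighted set with nonnegative weights and positive mass, let
`Y` take values in a finite set `T` and let `d(x, y) ≤ D` (`D ≥ 0`).  Assume
`𝐇(Y) ≥ log #T - η`, `𝐈(X : Y) ≤ κ`, and that for every value `x` of `X`,
`#{y ∈ T : d(x, y) ≥ λ} ≤ e^{-θ} #T` (`λ ≥ 0`, `θ > 0`).  Then for every `τ > 0`,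
`𝔼 d(X, Y) ≤ λ + D ((log 2 + η + τ)/θ + (κ + η)/τ)`.
(Values `x` with entropy drop `𝐇(Y) - 𝐇(Y | X = x) > τ` have total probability `≤ (κ+η)/τ`;
for the others, Lemma 3.3 bounds `ℙ(d ≥ λ | X = x)` by `(log 2 + η + τ)/θ`.)
[cite: TaoFMP2016, §3 (Lemma 3.3 and the displays following the proof of Lemma 3.5)] -/
theorem wsum_div_mass_le_of_mutualInfo_le (hw : ∀ i ∈ s, 0 ≤ w i) (hs : 0 < mass s w)
    (X : ι → α) (Y : ι → β) {T : Finset β} (hT : s.image Y ⊆ T) (d : α → β → ℝ) {D : ℝ}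
    (hD : 0 ≤ D) (hdD : ∀ x y, d x y ≤ D) {η κ θ lam τ : ℝ}
    (hθ : 0 < θ) (hτ : 0 < τ) (hlam : 0 ≤ lam) (hent : Real.log #T - η ≤ ent s w Y)
    (hI : mutualInfo s w X Y ≤ κ)
    (hconc : ∀ x ∈ s.image X, (#(T.filter fun y => lam ≤ d x y) : ℝ) ≤ Real.exp (-θ) * #T) :
    (∑ i ∈ s, w i * d (X i) (Y i)) / mass s w ≤
      lam + D * ((Real.log 2 + η + τ) / θ + (κ + η) / τ) := by
  -- notation: fibres, their conditional probabilities of the exceptional sets, entropy drops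
  set Sx : α → Finset ι := fun x => s.filter fun i => X i = x with hSx
  set Ex : α → Finset β := fun x => T.filter fun y => lam ≤ d x y with hEx
  set Px : α → ℝ := fun x => prob (Sx x) w (fun i => decide (Y i ∈ Ex x)) true with hPx
  set Dx : α → ℝ := fun x => ent s w Y - ent (Sx x) w Y with hDx
  set p : α → ℝ := fun x => prob s w X x with hp
  have hwx : ∀ x, ∀ i ∈ Sx x, 0 ≤ w i := fun x i hi => hw i (mem_of_mem_filter i hi)
  have hTx : ∀ x, (Sx x).image Y ⊆ T := fun x =>
    (image_subset_image (filter_subset _ _)).trans hT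
  have hp0 : ∀ x, 0 ≤ p x := fun x => prob_nonneg hw x
  have hPx0 : ∀ x, 0 ≤ Px x := fun x => prob_nonneg (hwx x) _
  have hPx1 : ∀ x, Px x ≤ 1 := fun x => prob_le_one (hwx x) _
  have hsum1 : ∑ x ∈ s.image X, p x = 1 := sum_prob_eq_one hs subset_rfl
  -- `η ≥ 0` (since `𝐇(Y) ≤ log #T`) and `D_x ≥ -η`
  have hentT : ent s w Y ≤ Real.log #T := ent_le_log_card hw hT
  have hη : 0 ≤ η := by linarith
  have hDxη : ∀ x, -η ≤ Dx x := fun x => by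
    have := ent_le_log_card (hwx x) (hTx x)
    simp only [hDx]; linarith
  -- Step B: on each fibre, `d ≤ λ + D · 1_{Y ∈ E_x}`
  have stepB : ∀ x, ∑ i ∈ Sx x, w i * d x (Y i) ≤ (lam + D * Px x) * mass (Sx x) w := by
    intro x
    have hpt : ∀ i ∈ Sx x, w i * d x (Y i) ≤
        w i * lam + D * (if decide (Y i ∈ Ex x) = true then w i else 0) := by
      intro i hi
      by_cases hY : Y i ∈ Ex x
      · have : decide (Y i ∈ Ex x) = true := by simpa using hY
        rw [this, if_pos rfl]
        nlinarith [hdD x (Y i), hwx x i hi]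
      · have : ¬(decide (Y i ∈ Ex x) = true) := by simpa using hY
        rw [if_neg this, mul_zero, add_zero]
        have hYT : Y i ∈ T := hTx x (mem_image_of_mem Y hi)
        have : d x (Y i) < lam := by
          by_contra hle
          exact hY (mem_filter.2 ⟨hYT, le_of_not_gt hle⟩)
        exact mul_le_mul_of_nonneg_left this.le (hwx x i hi)
    calc ∑ i ∈ Sx x, w i * d x (Y i)
        ≤ ∑ i ∈ Sx x, (w i * lam + D * (if decide (Y i ∈ Ex x) = true then w i else 0)) :=
          sum_le_sum hpt
      _ = lam * mass (Sx x) w + D * mass ((Sx x).filter fun i => decide (Y i ∈ Ex x) = true) w := by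
          have e1 : ∑ i ∈ Sx x, (if decide (Y i ∈ Ex x) = true then w i else 0) =
              mass ((Sx x).filter fun i => decide (Y i ∈ Ex x) = true) w := by
            rw [mass_def]
            exact (Finset.sum_filter (fun i => decide (Y i ∈ Ex x) = true) w).symm
          rw [sum_add_distrib, ← sum_mul, ← mul_sum, e1, ← mass_def]
          ring
      _ = (lam + D * Px x) * mass (Sx x) w := by
          rw [mass_filter_eq_prob_mul_mass (hwx x) (fun i => Y i ∈ Ex x)]
          simp only [hPx]
          ring
  -- Step C: good values, via Lemma 3.3 (`ent_le_of_event`)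
  have stepC : ∀ x ∈ s.image X, Dx x ≤ τ → Px x ≤ (Real.log 2 + η + τ) / θ := by
    intro x hx hgood
    rw [le_div_iff₀ hθ]
    rcases (Ex x).eq_empty_or_nonempty with hE | hE
    · -- empty exceptional set: `Px x = 0`
      have : Px x = 0 := by
        simp only [hPx, prob_def]
        have : (Sx x).filter (fun i => decide (Y i ∈ Ex x) = true) = ∅ := by
          rw [filter_eq_empty_iff]; intro i _; simp [hE]
        rw [this, mass_def, sum_empty, zero_div]
      rw [this, zero_mul]
      have : 0 ≤ Real.log 2 := Real.log_nonneg one_le_two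
      linarith
    · have hEpos : (0 : ℝ) < #(Ex x) := by exact_mod_cast hE.card_pos
      have hTpos : (0 : ℝ) < #T := lt_of_lt_of_le hEpos (by exact_mod_cast card_le_card (filter_subset _ _))
      have hlogE : Real.log #(Ex x) ≤ Real.log #T - θ := by
        calc Real.log #(Ex x) ≤ Real.log (Real.exp (-θ) * #T) := Real.log_le_log hEpos (hconc x hx)
          _ = Real.log #T - θ := by
              rw [Real.log_mul (Real.exp_pos _).ne' hTpos.ne', Real.log_exp]; ring
      have h33 := ent_le_of_event (s := Sx x) (Y := Y) (hwx x) (hTx x) (Ex x)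
      -- `ent (Sx x) Y ≥ log #T - η - τ`
      have hlow : Real.log #T - η - τ ≤ ent (Sx x) w Y := by
        simp only [hDx] at hgood; linarith
      have hmul : Px x * Real.log #(Ex x) ≤ Px x * (Real.log #T - θ) :=
        mul_le_mul_of_nonneg_left hlogE (hPx0 x)
      simp only [hPx] at hmul h33 ⊢
      nlinarith
  -- Step D: Markov for the bad values
  have stepD : ∑ x ∈ (s.image X).filter (fun x => τ < Dx x), p x ≤ (κ + η) / τ := by
    have hIsum : ∑ x ∈ s.image X, p x * Dx x = mutualInfo s w X Y :=
      (mutualInfo_eq_sum_fiber hw hs).symm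
    have h1 : ∑ x ∈ s.image X, p x * (Dx x + η) ≤ κ + η := by
      have : ∑ x ∈ s.image X, p x * (Dx x + η) = mutualInfo s w X Y + η := by
        simp_rw [mul_add]
        rw [sum_add_distrib, hIsum, ← sum_mul, hsum1, one_mul]
      linarith
    have h2 : τ * ∑ x ∈ (s.image X).filter (fun x => τ < Dx x), p x ≤
        ∑ x ∈ s.image X, p x * (Dx x + η) := by
      rw [mul_sum]
      calc ∑ x ∈ (s.image X).filter (fun x => τ < Dx x), τ * p x
          ≤ ∑ x ∈ (s.image X).filter (fun x => τ < Dx x), p x * (Dx x + η) := by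
            refine sum_le_sum fun x hx => ?_
            have hbad := (mem_filter.1 hx).2
            nlinarith [mul_nonneg (hp0 x) (show (0 : ℝ) ≤ Dx x + η - τ by linarith)]
        _ ≤ ∑ x ∈ s.image X, p x * (Dx x + η) :=
            sum_le_sum_of_subset_of_nonneg (filter_subset _ _) fun x _ _ =>
              mul_nonneg (hp0 x) (by have := hDxη x; linarith)
    rw [le_div_iff₀ hτ, mul_comm]
    linarith
  -- Step E: assemble
  have hfib : ∑ i ∈ s, w i * d (X i) (Y i) = ∑ x ∈ s.image X, ∑ i ∈ Sx x, w i * d x (Y i) := by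
    rw [← sum_fiberwise_of_maps_to (g := X) (fun i hi => mem_image_of_mem X hi)]
    refine sum_congr rfl fun x _ => sum_congr rfl fun i hi => ?_
    rw [(mem_filter.1 hi).2]
  have hmassx : ∀ x, mass (Sx x) w = p x * mass s w := fun x => by
    simp only [hp, prob_def]; rw [div_mul_cancel₀ _ hs.ne']
  rw [div_le_iff₀ hs, hfib]
  calc ∑ x ∈ s.image X, ∑ i ∈ Sx x, w i * d x (Y i)
      ≤ ∑ x ∈ s.image X, (lam + D * Px x) * mass (Sx x) w := sum_le_sum fun x _ => stepB x
    _ = (∑ x ∈ s.image X, (lam + D * Px x) * p x) * mass s w := by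
        rw [sum_mul]; exact sum_congr rfl fun x _ => by rw [hmassx x]; ring
    _ ≤ (lam + D * ((Real.log 2 + η + τ) / θ + (κ + η) / τ)) * mass s w := by
        refine mul_le_mul_of_nonneg_right ?_ hs.le
        -- split the `x`-sum into good and bad values
        have hsplit := sum_filter_add_sum_filter_not (s.image X) (fun x => τ < Dx x)
          (fun x => (lam + D * Px x) * p x)
        rw [← hsplit]
        set B := ∑ x ∈ (s.image X).filter (fun x => τ < Dx x), p x with hB
        set G := ∑ x ∈ (s.image X).filter (fun x => ¬τ < Dx x), p x with hG
        have hbad : ∑ x ∈ (s.image X).filter (fun x => τ < Dx x), (lam + D * Px x) * p x ≤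
            (lam + D) * B := by
          rw [hB, mul_sum]
          exact sum_le_sum fun x _ => by
            nlinarith [mul_nonneg (mul_nonneg hD (sub_nonneg.2 (hPx1 x))) (hp0 x)]
        have hgood : ∑ x ∈ (s.image X).filter (fun x => ¬τ < Dx x), (lam + D * Px x) * p x ≤
            (lam + D * ((Real.log 2 + η + τ) / θ)) * G := by
          rw [hG, mul_sum]
          exact sum_le_sum fun x hx => by
            have hx' := mem_filter.1 hx
            have := stepC x hx'.1 (le_of_not_gt hx'.2)
            nlinarith [mul_nonneg (mul_nonneg hD (sub_nonneg.2 this)) (hp0 x)]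
        have hBG : B + G = 1 := by
          rw [hB, hG, sum_filter_add_sum_filter_not, hsum1]
        have hB0 : 0 ≤ B := sum_nonneg fun x _ => hp0 x
        have hG0 : 0 ≤ G := sum_nonneg fun x _ => hp0 x
        have hG1 : G ≤ 1 := by linarith
        have hq0 : 0 ≤ (Real.log 2 + η + τ) / θ := by
          have : 0 ≤ Real.log 2 := Real.log_nonneg one_le_two
          positivity
        have hqG : (Real.log 2 + η + τ) / θ * G ≤ (Real.log 2 + η + τ) / θ :=
          mul_le_of_le_one_right hq0 hG1
        calc _ ≤ (lam + D) * B + (lam + D * ((Real.log 2 + η + τ) / θ)) * G := add_le_add hbad hgood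
          _ = lam * (B + G) + D * (B + (Real.log 2 + η + τ) / θ * G) := by ring
          _ ≤ lam * 1 + D * ((κ + η) / τ + (Real.log 2 + η + τ) / θ) := by
              rw [hBG]
              have := add_le_add stepD hqG
              nlinarith
          _ = lam + D * ((Real.log 2 + η + τ) / θ + (κ + η) / τ) := by ring

/-! ### The input `𝐇(Y) ≥ log N - η` from near-uniformity of the law of `Y` -/

/-- **Near-uniform laws have near-maximal entropy.**  If `Y` takes values in a nonempty finite
set `T` and `|ℙ(Y = b) - 1/#T| ≤ δ ≤ 1` for every `b ∈ T`, then
`𝐇(Y) ≥ log #T - #T (φ(δ) + δ)` (`φ = negMulLog`), by comparison with the uniform distribution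
on `T` (`ent_eq_log_card_of_uniform`) through `abs_ent_sub_ent_le`.  In Tao 2016, §3 this is
"`Y_H` is within `o(1)` of being uniformly distributed on `ℤ/P_Hℤ`, thus
`𝐇(Y_H) = log P_H - o(1)`" (display (3.9) of the arXiv version), the near-uniformity coming
from Lemma 2.5. [cite: TaoFMP2016, §3 (3.9)] -/
theorem log_card_sub_le_ent_of_near_uniform (hw : ∀ i ∈ s, 0 ≤ w i) (Y : ι → β)
    {T : Finset β} (hT : s.image Y ⊆ T) {δ : ℝ} (hδ1 : δ ≤ 1)
    (hclose : ∀ b ∈ T, |prob s w Y b - 1 / #T| ≤ δ) :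
    Real.log #T - #T * (negMulLog δ + δ) ≤ ent s w Y := by
  -- the uniform distribution on `T`: constant weight `1`, the identity random variable
  have hunif : ent T (fun _ => (1 : ℝ)) id = Real.log #T :=
    ent_eq_log_card_of_uniform one_pos (fun _ _ => rfl) (Set.injOn_id _)
  have hprobU : ∀ b ∈ T, prob T (fun _ => (1 : ℝ)) id b = 1 / #T := by
    intro b hb
    rw [prob_def, mass_def, mass_def, sum_const, sum_const, nsmul_eq_mul, nsmul_eq_mul, mul_one,
      mul_one]
    have : T.filter (fun i => id i = b) = {b} := by
      ext c; simp only [mem_filter, id_eq, mem_singleton]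
      exact ⟨fun h => h.2, fun h => ⟨h ▸ hb, h⟩⟩
    rw [this, card_singleton, Nat.cast_one]
  have himU : T.image id ⊆ T := by rw [image_id]
  have h := abs_ent_sub_ent_le (s := s) (w := w) (X := Y) (s' := T) (w' := fun _ => (1 : ℝ))
    (X' := id) hw (fun _ _ => zero_le_one) hT himU hδ1 (fun b hb => by
      rw [hprobU b hb]; exact hclose b hb)
  rw [hunif, abs_le] at h
  linarith [h.1]

end FiniteShannon

end Literature.Probability.Entropy
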